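import Summits.AtomisticToContinuum.Crystallization.Theorems.PalmUnimodularRigidityLayeredLawsSelectHcpLineSecondDiff

/-!
# Crux `LayeredLawsSelectHcp` (stmt-AtomisticToContinuum-9226), line `mtp-prestress-split-ergodic-frame`:
# vertical label columns of rooted charts are straight to second order
# (`tube_verticalTransfer`, `tube_columnSecondDiff`)

The far field of the rigidity certificate needs RANGE FLOORS for TALL chart labels
(`Cruxes/LayeredLawsSelectHcp/LeadC3FarField.md`), i.e. control of the vertical label column
`u, u + (2,0,0), u + (4,0,0), …` (sites stacked straight up, two layers apart).  The hcp contact graph has NO straight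
bond line off the basal plane: the bond path from `u` to `u + (2,0,0)` zigzags through the `B`-site `u + (1,0,0)`, so
the single-star straightness of `…LineSecondDiff` does not apply.  The cure is a SPECIFIC-VECTOR FRAME TRANSFER
(`Pᵢ = hcpSite 1 √(2/3)` below):

* `tube_verticalTransfer`: if `(a, A)` fits the star of a labelled configuration `X` re-rooted at a label `x`
  (`‖reRoot X x v − a • A (Pᵢ v)‖ ≤ a/100`, `v ∈ hcpStarIdx`) and `(a', A')` fits the star re-rooted at the vertically
  adjacent label `labelShift x c`, `c = (±1,0,0)`, then the two frames agree on the image of the ideal double-layer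
  vector `Pᵢ (2,0,0) = 2h ẑ` up to the parity sign: `‖a • A (Pᵢ (2,0,0)) + a' • A' (Pᵢ (2,0,0))‖ ≤ 4/75`.  Reason: the
  three bonds of `x` into the layer of `y = labelShift x c` (labels `c`, `labelShift c (0,1,0)`, `labelShift c (0,0,1)`:
  the cap triangle containing `y`) sum, ideally, to `±(3/2) Pᵢ (2,0,0)` (the hollow vectors cancel), and the SAME
  three atoms are read from `y` as `y` itself and its two in-layer star atoms `labelShift y (0,1,0)`,
  `labelShift y (0,0,1)`, while `x = labelShift y c`; so the sum of the three bond vectors is within `3a/100` of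
  `±(3/2) a A (Pᵢ (2,0,0))` and within `5a'/100` of `∓(3/2) a' A' (Pᵢ (2,0,0))`, whence
  `(3/2) ‖a A (Pᵢ (2,0,0)) + a' A' (Pᵢ (2,0,0))‖ ≤ 8/100`.
* `tube_columnSecondDiff`: for an every-point-good hcp-charted `S ∋ 0`, a rooted labelled chart `X` and an even label
  `u`, `‖X (u + (4,0,0)) − 2 • X (u + (2,0,0)) + X u‖ ≤ 4/25`: with `x₁ = u + (2,0,0)` and the `B`-sites
  `y₀ = labelShift x₁ (−1,0,0) = u + (1,0,0)`, `y₁ = labelShift x₁ (1,0,0) = u + (3,0,0)`, each double step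
  `X (u + (2,0,0)) − X u`, `X (u + (4,0,0)) − X (u + (2,0,0))` is a difference of two star bonds AT `y₀`, resp. `y₁`
  (labels `(∓1,0,0)`), hence within `2/100` of `−a′ A′ (Pᵢ (2,0,0))`, resp. `−a″ A″ (Pᵢ (2,0,0))`, for the frames at
  `y₀`, `y₁` (`exists_frame_reRoot`); two vertical transfers through the frame at `x₁` give
  `2/100 + 4/75 + 4/75 + 2/100 = 11/75 ≤ 4/25`.

All `[folklore]`.
-/

noncomputable section

namespace Summit.AtomisticToContinuum.Crystallization.Theorems.PalmUnimodularRigidity.LayeredLawsSelectHcp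

open MeasureTheory Set
open Literature.MathematicalPhysics.StatisticalMechanics Literature.Geometry.DiscreteGeometry
open Summit.AtomisticToContinuum.Crystallization.Theorems.LayeredLawsSelectHcp.Negative.DiracLaws (GoodShell)

/-! ## The ideal cap and side sums (any spacings `a`, `h`) -/

/-- **The ideal double-layer vector** `hcpSite a h (2,0,0) = 2h ẑ` is the up bond minus the down bond of label
`(±1,0,0)`. [folklore] -/
theorem vt_ideal_doubleLayer (a h : ℝ) : hcpSite a h (2, 0, 0) = hcpSite a h (1, 0, 0) - hcpSite a h (-1, 0, 0) := by
  ext l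
  fin_cases l <;>
    simp [hcpSite_apply_zero, hcpSite_apply_one, hcpSite_apply_two, haggLabel_alternating_of_odd odd_one,
      haggLabel_alternating_of_odd (by decide : Odd (-1 : ℤ)), haggLabel_alternating_of_even even_two]
  ring

/-- **Upper cap sum**: the three up bonds sum to `(3/2) • hcpSite a h (2,0,0)` (the hollow vectors cancel).
[folklore] -/
theorem vt_ideal_cap_up (a h : ℝ) :
    hcpSite a h (1, 0, 0) + hcpSite a h (1, -1, 0) + hcpSite a h (1, 0, -1) = (3 / 2 : ℝ) • hcpSite a h (2, 0, 0) := by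
  ext l
  fin_cases l <;>
    simp [hcpSite_apply_zero, hcpSite_apply_one, hcpSite_apply_two, haggLabel_alternating_of_odd odd_one,
      haggLabel_alternating_of_even even_two] <;> ring

/-- **Lower cap sum**: the three down bonds sum to `−(3/2) • hcpSite a h (2,0,0)`. [folklore] -/
theorem vt_ideal_cap_down (a h : ℝ) :
    hcpSite a h (-1, 0, 0) + hcpSite a h (-1, -1, 0) + hcpSite a h (-1, 0, -1) =
      (-(3 / 2) : ℝ) • hcpSite a h (2, 0, 0) := by
  ext l
  fin_cases l <;>
    simp [hcpSite_apply_zero, hcpSite_apply_one, hcpSite_apply_two,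
      haggLabel_alternating_of_odd (by decide : Odd (-1 : ℤ)), haggLabel_alternating_of_even even_two] <;> ring

/-- **Side sum, up**: `hcpSite (0,1,0) + hcpSite (0,0,1) − 3 • hcpSite (1,0,0) = −(3/2) • hcpSite (2,0,0)` (the upper
cap read from its own vertex). [folklore] -/
theorem vt_ideal_side_up (a h : ℝ) :
    hcpSite a h (0, 1, 0) + hcpSite a h (0, 0, 1) - (3 : ℝ) • hcpSite a h (1, 0, 0) =
      -((3 / 2 : ℝ) • hcpSite a h (2, 0, 0)) := by
  ext l
  fin_cases l <;>
    simp [hcpSite_apply_zero, hcpSite_apply_one, hcpSite_apply_two, haggLabel_alternating_of_odd odd_one,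
      haggLabel_alternating_of_even even_two] <;> ring

/-- **Side sum, down**: `hcpSite (0,1,0) + hcpSite (0,0,1) − 3 • hcpSite (−1,0,0) = (3/2) • hcpSite (2,0,0)` (the lower
cap read from its own vertex). [folklore] -/
theorem vt_ideal_side_down (a h : ℝ) :
    hcpSite a h (0, 1, 0) + hcpSite a h (0, 0, 1) - (3 : ℝ) • hcpSite a h (-1, 0, 0) =
      -((-(3 / 2) : ℝ) • hcpSite a h (2, 0, 0)) := by
  ext l
  fin_cases l <;>
    simp [hcpSite_apply_zero, hcpSite_apply_one, hcpSite_apply_two,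
      haggLabel_alternating_of_odd (by decide : Odd (-1 : ℤ)), haggLabel_alternating_of_even even_two] <;> ring

/-! ## Normed-space bookkeeping -/

/-- **The transfer core**: if one vector `S` is within `η₁` of `s • F₁` and within `η₂` of `−(s • F₂)`, `|s| = 3/2`,
then `‖F₁ + F₂‖ ≤ (2/3)(η₁ + η₂)`. [folklore] -/
theorem vt_transfer_core {V : Type*} [NormedAddCommGroup V] [NormedSpace ℝ V] {S F₁ F₂ : V} {s η₁ η₂ : ℝ}
    (hs : |s| = 3 / 2) (h1 : ‖S - s • F₁‖ ≤ η₁) (h2 : ‖S - -(s • F₂)‖ ≤ η₂) :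
    ‖F₁ + F₂‖ ≤ 2 / 3 * (η₁ + η₂) := by
  have e : s • (F₁ + F₂) = (S - -(s • F₂)) - (S - s • F₁) := by rw [smul_add]; abel
  have hn : ‖s • (F₁ + F₂)‖ ≤ η₂ + η₁ := by
    rw [e]; exact (norm_sub_le _ _).trans (add_le_add h2 h1)
  rw [norm_smul, Real.norm_eq_abs, hs] at hn
  linarith

/-- **Three bonds fitted by one frame, summed**. [folklore] -/
theorem vt_norm_add₃_fit {V : Type*} [NormedAddCommGroup V] {p₁ p₂ p₃ f₁ f₂ f₃ : V} {η : ℝ}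
    (h1 : ‖p₁ - f₁‖ ≤ η) (h2 : ‖p₂ - f₂‖ ≤ η) (h3 : ‖p₃ - f₃‖ ≤ η) :
    ‖(p₁ + p₂ + p₃) - (f₁ + f₂ + f₃)‖ ≤ 3 * η := by
  have e : (p₁ + p₂ + p₃) - (f₁ + f₂ + f₃) = (p₁ - f₁) + (p₂ - f₂) + (p₃ - f₃) := by abel
  rw [e]
  exact norm_add₃_le.trans (by linarith)

/-- **Two bonds minus three times a third, fitted by one frame**. [folklore] -/
theorem vt_norm_side_fit {V : Type*} [NormedAddCommGroup V] [NormedSpace ℝ V] {q₂ q₃ r g₂ g₃ g : V} {η : ℝ}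
    (h2 : ‖q₂ - g₂‖ ≤ η) (h3 : ‖q₃ - g₃‖ ≤ η) (hr : ‖r - g‖ ≤ η) :
    ‖(q₂ + q₃ - (3 : ℝ) • r) - (g₂ + g₃ - (3 : ℝ) • g)‖ ≤ 5 * η := by
  have e : (q₂ + q₃ - (3 : ℝ) • r) - (g₂ + g₃ - (3 : ℝ) • g) = (q₂ - g₂) + (q₃ - g₃) - (3 : ℝ) • (r - g) := by
    rw [smul_sub]; abel
  have h3r : ‖(3 : ℝ) • (r - g)‖ ≤ 3 * η := by
    rw [norm_smul, Real.norm_of_nonneg (by norm_num : (0 : ℝ) ≤ 3)]; linarith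
  rw [e]
  calc ‖(q₂ - g₂) + (q₃ - g₃) - (3 : ℝ) • (r - g)‖
      ≤ ‖(q₂ - g₂) + (q₃ - g₃)‖ + ‖(3 : ℝ) • (r - g)‖ := norm_sub_le _ _
    _ ≤ ‖q₂ - g₂‖ + ‖q₃ - g₃‖ + ‖(3 : ℝ) • (r - g)‖ := by gcongr; exact norm_add_le _ _
    _ ≤ 5 * η := by linarith

/-- **A double step is a difference of two star bonds at the intermediate site**: `‖(p − q) + (g − f)‖ ≤ η + η` from
`‖p − f‖ ≤ η`, `‖q − g‖ ≤ η`. [folklore] -/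
theorem vt_norm_doubleStep {V : Type*} [NormedAddCommGroup V] {p q f g : V} {η : ℝ} (hp : ‖p - f‖ ≤ η)
    (hq : ‖q - g‖ ≤ η) : ‖(p - q) + (g - f)‖ ≤ η + η := by
  have e : (p - q) + (g - f) = (p - f) - (q - g) := by abel
  rw [e]
  exact (norm_sub_le _ _).trans (add_le_add hp hq)

/-! ## The vertical transfer -/

/-- **The vertical transfer, abstract form** (`Pᵢ = hcpSite 1 √(2/3)`).  Let `c, t₂, t₃` be star labels with
`labelShift c (0,1,0) = t₂`, `labelShift c (0,0,1) = t₃`, `labelShift c c = 0`, and ideal sums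
`Pᵢ c + Pᵢ t₂ + Pᵢ t₃ = s • Pᵢ (2,0,0)`, `Pᵢ (0,1,0) + Pᵢ (0,0,1) − 3 • Pᵢ c = −(s • Pᵢ (2,0,0))`, `|s| = 3/2`.  If
`(a, A)` fits the star of `reRoot X x` within `a/100` and `(a', A')` the star of `reRoot X (labelShift x c)` within
`a'/100`, then `‖a • A (Pᵢ (2,0,0)) + a' • A' (Pᵢ (2,0,0))‖ ≤ (2/3)(3a/100 + 5a'/100)`: the three bond vectors
`X (labelShift x tᵢ) − X x` (`t₁ = c`) sum to a vector within `3a/100` of `s • a A (Pᵢ (2,0,0))`, and, read from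
`y = labelShift x c` (`labelShift y (0,1,0) = labelShift x t₂`, `labelShift y (0,0,1) = labelShift x t₃`,
`labelShift y c = x`, by `labelShift_labelShift`), to the same vector within `5a'/100` of `−s • a' A' (Pᵢ (2,0,0))`
(`vt_transfer_core`). [folklore] -/
theorem vt_transfer_of_fits {X : ℤ × ℤ × ℤ → EuclideanSpace ℝ (Fin 3)} {x c t₂ t₃ : ℤ × ℤ × ℤ} {s : ℝ}
    (hc : c ∈ hcpStarIdx) (ht₂ : t₂ ∈ hcpStarIdx) (ht₃ : t₃ ∈ hcpStarIdx) (h₂ : labelShift c (0, 1, 0) = t₂)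
    (h₃ : labelShift c (0, 0, 1) = t₃) (hcc : labelShift c c = 0) (hs : |s| = 3 / 2)
    (hcap : hcpSite 1 (Real.sqrt (2 / 3)) c + hcpSite 1 (Real.sqrt (2 / 3)) t₂ + hcpSite 1 (Real.sqrt (2 / 3)) t₃ =
      s • hcpSite 1 (Real.sqrt (2 / 3)) (2, 0, 0))
    (hside : hcpSite 1 (Real.sqrt (2 / 3)) (0, 1, 0) + hcpSite 1 (Real.sqrt (2 / 3)) (0, 0, 1) -
      (3 : ℝ) • hcpSite 1 (Real.sqrt (2 / 3)) c = -(s • hcpSite 1 (Real.sqrt (2 / 3)) (2, 0, 0)))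
    {a a' : ℝ} {A A' : EuclideanSpace ℝ (Fin 3) ≃ₗᵢ[ℝ] EuclideanSpace ℝ (Fin 3)}
    (hA : ∀ v ∈ hcpStarIdx, ‖reRoot X x v - a • A (hcpSite 1 (Real.sqrt (2 / 3)) v)‖ ≤ a / 100)
    (hA' : ∀ v ∈ hcpStarIdx, ‖reRoot X (labelShift x c) v - a' • A' (hcpSite 1 (Real.sqrt (2 / 3)) v)‖ ≤ a' / 100) :
    ‖a • A (hcpSite 1 (Real.sqrt (2 / 3)) (2, 0, 0)) + a' • A' (hcpSite 1 (Real.sqrt (2 / 3)) (2, 0, 0))‖ ≤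
      2 / 3 * (3 * (a / 100) + 5 * (a' / 100)) := by
  have h010 : ((0, 1, 0) : ℤ × ℤ × ℤ) ∈ hcpStarIdx := by decide
  have h001 : ((0, 0, 1) : ℤ × ℤ × ℤ) ∈ hcpStarIdx := by decide
  have p1 := hA c hc
  have p2 := hA t₂ ht₂
  have p3 := hA t₃ ht₃
  have q2 := hA' (0, 1, 0) h010
  have q3 := hA' (0, 0, 1) h001
  have r := hA' c hc
  have L2 : labelShift (labelShift x c) (0, 1, 0) = labelShift x t₂ := by rw [← labelShift_labelShift, h₂]
  have L3 : labelShift (labelShift x c) (0, 0, 1) = labelShift x t₃ := by rw [← labelShift_labelShift, h₃]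
  have Lc : labelShift (labelShift x c) c = x := by rw [← labelShift_labelShift, hcc, labelShift_zero]
  simp only [reRoot] at p1 p2 p3 q2 q3 r
  rw [L2] at q2
  rw [L3] at q3
  rw [Lc] at r
  -- the sum of the three bond vectors, read from `x`
  have hx := vt_norm_add₃_fit p1 p2 p3
  have e1 : a • A (hcpSite 1 (Real.sqrt (2 / 3)) c) + a • A (hcpSite 1 (Real.sqrt (2 / 3)) t₂) +
      a • A (hcpSite 1 (Real.sqrt (2 / 3)) t₃) = s • (a • A (hcpSite 1 (Real.sqrt (2 / 3)) (2, 0, 0))) := by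
    rw [← smul_add, ← smul_add, ← map_add, ← map_add, hcap, LinearIsometryEquiv.map_smul, smul_comm]
  rw [e1] at hx
  -- the same sum, read from `y = labelShift x c`
  have hy := vt_norm_side_fit q2 q3 r
  have e2 : a' • A' (hcpSite 1 (Real.sqrt (2 / 3)) (0, 1, 0)) + a' • A' (hcpSite 1 (Real.sqrt (2 / 3)) (0, 0, 1)) -
      (3 : ℝ) • (a' • A' (hcpSite 1 (Real.sqrt (2 / 3)) c)) =
      -(s • (a' • A' (hcpSite 1 (Real.sqrt (2 / 3)) (2, 0, 0)))) := by
    have h := congrArg (⇑A') hside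
    simp only [map_add, map_sub, map_neg, LinearIsometryEquiv.map_smul] at h
    linear_combination (norm := module) a' • h
  rw [e2] at hy
  have eS : X (labelShift x t₂) - X (labelShift x c) + (X (labelShift x t₃) - X (labelShift x c)) -
      (3 : ℝ) • (X x - X (labelShift x c)) =
      X (labelShift x c) - X x + (X (labelShift x t₂) - X x) + (X (labelShift x t₃) - X x) := by
    module
  rw [eS] at hy
  exact vt_transfer_core hs hx hy

/-- **Registered primitive `tube_verticalTransfer`: frames at vertically adjacent labels agree on the double-layer
vector.**  For any labelled configuration `X : ℤ³ → ℝ³`, any label `x` and `c = (±1,0,0)`: if `(a, A)`, `a ≤ 1`, fits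
the star of `reRoot X x` within `a/100` and `(a', A')`, `a' ≤ 1`, fits the star of `reRoot X (labelShift x c)` within
`a'/100` (as produced by `exists_frame_reRoot`), then `‖a • A (Pᵢ (2,0,0)) + a' • A' (Pᵢ (2,0,0))‖ ≤ 4/75`
(`Pᵢ = hcpSite 1 √(2/3)`, `Pᵢ (2,0,0) = 2h ẑ` of norm `2√(2/3)`; the `+` is the parity sign between adjacent layers).
By `vt_transfer_of_fits` with the cap `c, labelShift c (0,1,0), labelShift c (0,0,1)` and the ideal sums
`vt_ideal_cap_up/down`, `vt_ideal_side_up/down`. [folklore] -/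
theorem tube_verticalTransfer : ∀ X : ℤ × ℤ × ℤ → EuclideanSpace ℝ (Fin 3), ∀ x c : ℤ × ℤ × ℤ, (c = (1, 0, 0) ∨ c = (-1, 0, 0)) → ∀ (a : ℝ) (A : EuclideanSpace ℝ (Fin 3) ≃ₗᵢ[ℝ] EuclideanSpace ℝ (Fin 3)) (a' : ℝ) (A' : EuclideanSpace ℝ (Fin 3) ≃ₗᵢ[ℝ] EuclideanSpace ℝ (Fin 3)), a ≤ 1 → a' ≤ 1 → (∀ v ∈ hcpStarIdx, ‖reRoot X x v - a • A (hcpSite 1 (Real.sqrt (2 / 3)) v)‖ ≤ a / 100) → (∀ v ∈ hcpStarIdx, ‖reRoot X (labelShift x c) v - a' • A' (hcpSite 1 (Real.sqrt (2 / 3)) v)‖ ≤ a' / 100) → ‖a • A (hcpSite 1 (Real.sqrt (2 / 3)) (2, 0, 0)) + a' • A' (hcpSite 1 (Real.sqrt (2 / 3)) (2, 0, 0))‖ ≤ 4 / 75 := by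
  intro X x c hc a A a' A' h1 h1' hA hA'
  rcases hc with rfl | rfl
  · refine (vt_transfer_of_fits (t₂ := (1, -1, 0)) (t₃ := (1, 0, -1)) (by decide) (by decide) (by decide)
      (by decide) (by decide) (by decide) (s := 3 / 2) (by norm_num) (vt_ideal_cap_up _ _) (vt_ideal_side_up _ _)
      hA hA').trans ?_
    linarith
  · refine (vt_transfer_of_fits (t₂ := (-1, -1, 0)) (t₃ := (-1, 0, -1)) (by decide) (by decide) (by decide)
      (by decide) (by decide) (by decide) (s := -(3 / 2)) (by norm_num) (vt_ideal_cap_down _ _)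
      (vt_ideal_side_down _ _) hA hA').trans ?_
    linarith

/-! ## The vertical column -/

/-- **The labels of the column.**  For an even label `u` and `x₁ = u + (2,0,0)` (even): the `B`-sites
`y₀ = labelShift x₁ (−1,0,0)`, `y₁ = labelShift x₁ (1,0,0)` (odd) have `labelShift y₀ (−1,0,0) = u + (2,0,0)`,
`labelShift y₀ (1,0,0) = u`, `labelShift y₁ (−1,0,0) = u + (4,0,0)`, `labelShift y₁ (1,0,0) = u + (2,0,0)`. [folklore] -/
theorem vt_column_labels {u : ℤ × ℤ × ℤ} (hu : Even u.1) :
    labelShift (labelShift (u + (2, 0, 0)) (-1, 0, 0)) (-1, 0, 0) = u + (2, 0, 0) ∧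
    labelShift (labelShift (u + (2, 0, 0)) (-1, 0, 0)) (1, 0, 0) = u ∧
    labelShift (labelShift (u + (2, 0, 0)) (1, 0, 0)) (-1, 0, 0) = u + (4, 0, 0) ∧
    labelShift (labelShift (u + (2, 0, 0)) (1, 0, 0)) (1, 0, 0) = u + (2, 0, 0) := by
  obtain ⟨k, i, j⟩ := u
  simp only [labelShift, Int.even_iff, Prod.mk_add_mk, Prod.mk_sub_mk] at hu ⊢
  split_ifs <;> simp only [Prod.mk_add_mk, Prod.mk_sub_mk, Prod.mk.injEq] <;> omega

/-- **Registered sub-goal `tube_columnSecondDiff`: vertical label columns of a rooted chart are straight to second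
order.**  For an every-point-good hcp-charted `S ∋ 0`, a rooted labelled chart `X` of `S` and an even label `u`,
`‖X (u + (4,0,0)) − 2 • X (u + (2,0,0)) + X u‖ ≤ 4/25`: with `x₁ = u + (2,0,0)`, `y₀ = labelShift x₁ (−1,0,0)`,
`y₁ = labelShift x₁ (1,0,0)` and frames `(a, A)`, `(a′, A′)`, `(a″, A″)` at `x₁, y₀, y₁` (`exists_frame_reRoot`), the
double steps `X (u + (2,0,0)) − X u = reRoot X y₀ (−1,0,0) − reRoot X y₀ (1,0,0)` and
`X (u + (4,0,0)) − X (u + (2,0,0)) = reRoot X y₁ (−1,0,0) − reRoot X y₁ (1,0,0)` (`vt_column_labels`) are within `2/100`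
of `−a′ A′ (Pᵢ (2,0,0))`, `−a″ A″ (Pᵢ (2,0,0))` (`vt_ideal_doubleLayer`, `Pᵢ = hcpSite 1 √(2/3)`), and
`tube_verticalTransfer` twice (through the frame at `x₁`) gives `2/100 + 4/75 + 4/75 + 2/100 = 11/75 ≤ 4/25`.
[folklore] -/
theorem tube_columnSecondDiff : ∀ S : Set (EuclideanSpace ℝ (Fin 3)), ∀ X : ℤ × ℤ × ℤ → EuclideanSpace ℝ (Fin 3), (0 : EuclideanSpace ℝ (Fin 3)) ∈ S → (∀ x ∈ S, GoodShell S x) → HcpCharted S → IsRootedChart S X → ∀ u : ℤ × ℤ × ℤ, Even u.1 → ‖X (u + (4, 0, 0)) - (2 : ℝ) • X (u + (2, 0, 0)) + X u‖ ≤ 4 / 25 := by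
  intro S X _ hgood hch hX u hu
  obtain ⟨a, _, h1, A, hA⟩ := exists_frame_reRoot hgood hch hX (u + (2, 0, 0))
  obtain ⟨a', _, h1', A', hA'⟩ := exists_frame_reRoot hgood hch hX (labelShift (u + (2, 0, 0)) (-1, 0, 0))
  obtain ⟨a'', _, h1'', A'', hA''⟩ := exists_frame_reRoot hgood hch hX (labelShift (u + (2, 0, 0)) (1, 0, 0))
  have T0 := tube_verticalTransfer X (u + (2, 0, 0)) (-1, 0, 0) (Or.inr rfl) a A a' A' h1 h1' hA hA'
  have T1 := tube_verticalTransfer X (u + (2, 0, 0)) (1, 0, 0) (Or.inl rfl) a A a'' A'' h1 h1'' hA hA''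
  rw [vt_ideal_doubleLayer, map_sub, map_sub, smul_sub, smul_sub] at T0 T1
  have hm : ((-1, 0, 0) : ℤ × ℤ × ℤ) ∈ hcpStarIdx := by decide
  have hp : ((1, 0, 0) : ℤ × ℤ × ℤ) ∈ hcpStarIdx := by decide
  obtain ⟨L1, L2, L3, L4⟩ := vt_column_labels hu
  have p0 := hA' (-1, 0, 0) hm
  have q0 := hA' (1, 0, 0) hp
  have p1 := hA'' (-1, 0, 0) hm
  have q1 := hA'' (1, 0, 0) hp
  simp only [reRoot] at p0 q0 p1 q1
  rw [L1] at p0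
  rw [L2] at q0
  rw [L3] at p1
  rw [L4] at q1
  have D0 := vt_norm_doubleStep p0 q0
  have D1 := vt_norm_doubleStep p1 q1
  set y₀ := labelShift (u + (2, 0, 0)) (-1, 0, 0)
  set y₁ := labelShift (u + (2, 0, 0)) (1, 0, 0)
  have e : X (u + (4, 0, 0)) - (2 : ℝ) • X (u + (2, 0, 0)) + X u =
      ((X (u + (4, 0, 0)) - X y₁ - (X (u + (2, 0, 0)) - X y₁)) +
          (a'' • A'' (hcpSite 1 (Real.sqrt (2 / 3)) (1, 0, 0)) - a'' • A'' (hcpSite 1 (Real.sqrt (2 / 3)) (-1, 0, 0)))) -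
        ((a • A (hcpSite 1 (Real.sqrt (2 / 3)) (1, 0, 0)) - a • A (hcpSite 1 (Real.sqrt (2 / 3)) (-1, 0, 0))) +
          (a'' • A'' (hcpSite 1 (Real.sqrt (2 / 3)) (1, 0, 0)) - a'' • A'' (hcpSite 1 (Real.sqrt (2 / 3)) (-1, 0, 0)))) +
        ((a • A (hcpSite 1 (Real.sqrt (2 / 3)) (1, 0, 0)) - a • A (hcpSite 1 (Real.sqrt (2 / 3)) (-1, 0, 0))) +
          (a' • A' (hcpSite 1 (Real.sqrt (2 / 3)) (1, 0, 0)) - a' • A' (hcpSite 1 (Real.sqrt (2 / 3)) (-1, 0, 0)))) -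
        ((X (u + (2, 0, 0)) - X y₀ - (X u - X y₀)) +
          (a' • A' (hcpSite 1 (Real.sqrt (2 / 3)) (1, 0, 0)) - a' • A' (hcpSite 1 (Real.sqrt (2 / 3)) (-1, 0, 0)))) := by
    module
  rw [e]
  refine (norm_sub_le_of_le (norm_add_le_of_le (norm_sub_le_of_le D1 T1) T0) D0).trans ?_
  linarith

end Summit.AtomisticToContinuum.Crystallization.Theorems.PalmUnimodularRigidity.LayeredLawsSelectHcp

end
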